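import Literature.NumberTheory.NumberFields.ArtinMapLocalNormKernel                      -- ★ Neukirch VI (5.6) at finite level along `canonicalArtin`
import Literature.NumberTheory.NumberFields.IdelicArtinMapRestriction                    -- ★ `eq_of_forall_abRestrict_eq`
import Literature.NumberTheory.NumberFields.IdelicArtinMap                               -- ★ `ideleArtinMap`, `abRestrict_ideleArtinMap`, `abRestrict_absGaloisAbProj`
import Literature.NumberTheory.GaloisRepresentations.LocalGaloisGroupProofs               -- ★ `IsAbsArithFrob.isFrobPow_holds`, `IsFrobPow.mul_holds`, `IsFrobPow.unique_holds`
import Literature.NumberTheory.Automorphic.Liu2021.AppendixC.RecordFrobeniusOrientationTest  -- ★ `isArtinCorrespondent_uniformizerIdele_inv_iff` (the converse direction)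
import HarnessLib

/-!
# A LOCAL arithmetic Frobenius at `v`, transported to `ℂ`, is an ARTIN CORRESPONDENT of an inverse-uniformiser idèle at `v`

Topic `NumberTheory/NumberFields` (global class field theory, idelic dictionary); namespace `Literature.NumberTheory.NumberFields`.  THEOREMS ONLY
(no definition, no named fact, no instance, no notation, no `sorry`; net debt 0).  Cell `hodgecm-mathlib`, FLOOR 0, P6 «MOD programme» (crux hLiu418 =
stmt-HodgeConjecture-24832, `--supports`), X-LEAF sheet line: the ARTIN SEAM (i) of the (FROB-𝔞)∕(FROB-can) discharge of `stub_ESHEET` (A-p01 (g28) memo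
`MEMO-ESHEET-organs.v1` (S6)∕(S7); «L4» LA4-plan (g0) DEAL #22 offer (b) ∕ #22b): the E-READINGS rows quantify a LOCAL arithmetic Frobenius
`σ ∈ Γ_{F_w}` (★ `IsAbsArithFrob`), while CM reciprocity (`PELWitnessE.cm_recip`, ★ `cmConjugationIsogenyAll_holds`) is keyed by an Artin
correspondent `s` of an automorphism of `ℂ` (★ `UnitaryCanonicalModel.IsArtinCorrespondent`, Milne's `art = rec⁻¹`); this file supplies the bridge.

THE MATHEMATICS ([NeukirchANT1999] VI (5.6)–(5.7): the global norm residue symbol restricted to `K_vˣ` is the local one; [TateCorvallis1979] (1.4.1):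
the Weil group and Deligne's normalisation of the local Artin map, geometric Frobenius ↦ uniformiser; [Milne2005ShimuraVarieties] (59): `art_E(s) = rec_E(s)⁻¹`).
Let `σ ∈ Γ_{K_v}` be an arithmetic Frobenius (any element of its inertia coset).  It lies in the Weil group with degree `1`, so its canonical local Artin
element `Art_v σ ∈ K_vˣ` is the INVERSE of a uniformiser `ϖ` (the unit `ϖ ∕ ϖ_v` is the inertia component of `σ`).  By (5.6) at every finite abelian
layer (★ `artinIdeleMap_localUnits_canonicalArtin_eq_inv`) and separation of `Γ_K^{ab}` by finite layers, the class of `res σ ∈ Γ_K` in `Γ_K^{ab}` is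
`[⟨Art_v σ⟩_v, K]⁻¹ = ( ⟨ϖ⟩_v , K)`.  Transporting `σ` to `ℂ` along any ring isomorphism `ρ : K̄_v ≃ ℂ` over `τ : K → ℂ` and taking
`e := ρ ∘ (K̄ → K̄_v)`, the pair `(e, res σ)` witnesses `IsArtinCorrespondent K τ (ϖ⁻¹)_v (ρ σ ρ⁻¹)`.

* §1 **`absGaloisAbProj_absGaloisRestrict_weil_eq_inv`** — (5.6) in the limit: `[res w]^{ab} = [⟨Art_v w⟩_v, K]⁻¹` for every `w ∈ W_{K_v}`.
* §2 `exists_weilGroup_of_isAbsArithFrob` (an arithmetic Frobenius is a Weil element of degree `1`), `isUniformizer_canonicalArtin_inv`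
  (`(Art_v w)⁻¹` is a uniformiser for `deg w = 1`).
* §3 HEAD **`exists_isArtinCorrespondent_of_isAbsArithFrob`** — `∃ ϖ` uniformiser, `IsArtinCorrespondent K τ (uniformizerIdele K v ϖ)⁻¹ (ρ ∘ σ ∘ ρ⁻¹)`.
* §4 (ED. 2) `absRestrictNormalHom_absGaloisRestrict_eq_galFrob_of_isAbsArithFrob` — the unramified reading: `(res σ)|_L = Frob_v` for every finite
  abelian `L ⊆ K̄` unramified at `v` (the private assembly of ★ `HilbertClassFieldMaximal` made public, fed with ★ `isArithFrobAt_absGaloisRestrict_adicCompletionPrime_iff`).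
The converse reading (correspondent of `(ϖ⁻¹)_v` ⇒ Frobenius on unramified layers) is ★ `Liu2021/AppendixC/RecordFrobeniusOrientationTest`
(`isArtinCorrespondent_uniformizerIdele_inv_iff`, `absRestrictNormalHom_eq_galFrob_of_isArtinCorrespondent`).  Budgets: default heartbeats.

References: [NeukirchANT1999] J. Neukirch, *Algebraic Number Theory* (1999), Ch. VI §5 Prop. (5.6), Cor. (5.7) (pp. 391–392); [TateCorvallis1979]
J. Tate, *Number theoretic background*, Proc. Symp. Pure Math. 33.2 (1979), (1.4.1); [Milne2005ShimuraVarieties] J. S. Milne, *Introduction to Shimura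
varieties* (2005), (59) p. 107; [SerreLocalFields1979] J.-P. Serre, *Local Fields* (1979), Ch. XIII §4 Thm. 1–2.
HC_CM is proved only modulo the printed citations (2 remaining named inputs hLiu418 24832, h413 24833) until rung 0 closes — count-neutral.
-/

set_option autoImplicit false

noncomputable section

open NumberField IsDedekindDomain
open Literature.NumberTheory.Automorphic Literature.NumberTheory.Automorphic.Liu2021.AppendixC
open Literature.NumberTheory.GaloisRepresentations
open Literature.AlgebraicGeometry.ShimuraVarieties Literature.AlgebraicGeometry.ShimuraVarieties.UnitaryCanonicalModel

namespace Literature.NumberTheory.NumberFields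

variable {K : Type} [Field K] [NumberField K] (v : HeightOneSpectrum (𝓞 K))

/-! ## §1 Neukirch (5.6) in the limit: `[res w]^{ab} = [⟨Art_v w⟩_v, K]⁻¹` in `Gal(K^ab ∕ K)` -/

/-- **Local–global compatibility in the limit (Neukirch VI (5.6)–(5.7) for the universal symbol).**  For `w ∈ W_{K_v}` with image
`res w ∈ Γ_K` (restriction along the tree's chosen `K̄ → K̄_v`), the class of `res w` in `Γ_K^{ab} = Gal(K^{ab}∕K)` is the INVERSE of the
idelic Artin symbol `[⟨Art_v w⟩_v, K]` of the local idèle carrying the canonical local Artin element `Art_v w ∈ K_vˣ` (Deligne's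
normalisation: geometric Frobenius ↦ uniformiser).  Proof: two elements of `Γ_K^{ab}` agree iff they agree on every finite abelian layer
(★ `eq_of_forall_abRestrict_eq`), where this is ★ `artinIdeleMap_localUnits_canonicalArtin_eq_inv`.
[cite: NeukirchANT1999, Ch. VI §5 Prop. (5.6) and Cor. (5.7)] [cite: TateCorvallis1979, (1.4.1)] -/
theorem absGaloisAbProj_absGaloisRestrict_weil_eq_inv (w : WeilGroup (v.adicCompletion K)) :
    absGaloisAbProj K (absGaloisRestrict K (v.adicCompletion K) (WeilGroup.toAbsGalois (v.adicCompletion K) w)) =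
      (ideleArtinMap K (localUnits v (canonicalArtin (v.adicCompletion K) w)))⁻¹ := by
  refine eq_of_forall_abRestrict_eq fun L _ _ => ?_
  rw [map_inv, abRestrict_absGaloisAbProj, abRestrict_ideleArtinMap, artinIdeleMap_localUnits_canonicalArtin_eq_inv, inv_inv]

/-! ## §2 An arithmetic Frobenius is a Weil element of degree `1`; its canonical Artin element is an inverse uniformiser -/

/-- **An (absolute) arithmetic Frobenius of `K_v` lies in the Weil group with degree `1`** (★ `IsAbsArithFrob.isFrobPow_holds`,
★ `WeilGroup.deg_eq_iff`). [cite: TateCorvallis1979, (1.4.1)] -/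
theorem exists_weilGroup_of_isAbsArithFrob {σ : Field.absoluteGaloisGroup (v.adicCompletion K)} (hσ : IsAbsArithFrob σ) :
    ∃ w : WeilGroup (v.adicCompletion K), WeilGroup.toAbsGalois (v.adicCompletion K) w = σ ∧ WeilGroup.deg w = 1 :=
  ⟨WeilGroup.mk σ ⟨1, IsAbsArithFrob.isFrobPow_holds hσ⟩, rfl,
    (WeilGroup.deg_eq_iff IsFrobPow.mul_holds IsFrobPow.unique_holds).2 (IsAbsArithFrob.isFrobPow_holds hσ)⟩

/-- **The canonical local Artin element of a degree-`1` (arithmetic Frobenius) Weil element is an INVERSE UNIFORMISER** — Deligne's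
normalisation `Art_v(geometric Frobenius) = uniformiser` (clause `artin_frob` of ★ `isLocalArtinMap_canonicalArtin_holds`) applied to `w⁻¹`.
[cite: TateCorvallis1979, (1.4.1)] [cite: SerreLocalFields1979, Ch. XIII §4 Thm. 1–2] -/
theorem isUniformizer_canonicalArtin_inv {w : WeilGroup (v.adicCompletion K)} (hw : WeilGroup.deg w = 1) :
    (ValuativeRel.valuation (v.adicCompletion K)).IsUniformizer
      (((canonicalArtin (v.adicCompletion K) w)⁻¹ : (v.adicCompletion K)ˣ) : v.adicCompletion K) := by
  have h := (isLocalArtinMap_canonicalArtin_holds (v.adicCompletion K)).artin_frob w⁻¹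
    (by rw [WeilGroup.deg_inv IsFrobPow.mul_holds IsFrobPow.unique_holds, hw])
  rwa [map_inv] at h

/-! ## §3 The head: local arithmetic Frobenius ⇒ Artin correspondent of an inverse-uniformiser idèle -/

/-- **LOCAL ARITHMETIC FROBENIUS ⇒ ARTIN CORRESPONDENT.**  Let `K` be a CM number field with complex embedding `τ`, `v` a finite place,
`σ ∈ Γ_{K_v}` an (absolute) arithmetic Frobenius (`IsAbsArithFrob σ` — any element of its inertia coset), and `ρ : K̄_v ≃ ℂ` a ring
isomorphism over `τ` (★ `AdicCompletionAlgClosureEquivComplex`).  Then the transported automorphism `σ̃ := ρ ∘ σ ∘ ρ⁻¹ ∈ Aut(ℂ∕τK)`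
corresponds under the ARTIN map (★ `IsArtinCorrespondent`, Milne's `art = rec⁻¹`) to the finite idèle `(ϖ⁻¹)_v` for SOME uniformiser `ϖ`
of `K_v` — namely `ϖ := (Art_v w)⁻¹` for the Weil element `w` over `σ`; the unit `ϖ∕ϖ_v` is the inertia component of `σ`, so no fixed
uniformiser serves every `σ`.  Witnesses: `e := ρ ∘ (K̄ → K̄_v)` (the tree's chosen embedding) and `γ := res σ`, with
`[γ]^{ab} = [⟨Art_v w⟩_v, K]⁻¹ = ( ⟨ϖ⟩_v , K)` (§1).  Converse direction and the Frobenius reading on unramified layers: ★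
`isArtinCorrespondent_uniformizerIdele_inv_iff`, ★ `theta_frobenius`.
[cite: NeukirchANT1999, Ch. VI §5 Prop. (5.6) and Cor. (5.7)] [cite: Milne2005ShimuraVarieties, (59) p. 107] [cite: TateCorvallis1979, (1.4.1)] -/
theorem exists_isArtinCorrespondent_of_isAbsArithFrob [IsCMField K] (τ : K →+* ℂ)
    {σ : Field.absoluteGaloisGroup (v.adicCompletion K)} (hσ : IsAbsArithFrob σ)
    (ρ : AlgebraicClosure (v.adicCompletion K) ≃+* ℂ)
    (hρ : (ρ : AlgebraicClosure (v.adicCompletion K) →+* ℂ).comp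
      (algebraMap K (AlgebraicClosure (v.adicCompletion K))) = τ) :
    ∃ ϖ : (v.adicCompletion K)ˣ, (ValuativeRel.valuation (v.adicCompletion K)).IsUniformizer (ϖ : v.adicCompletion K) ∧
      IsArtinCorrespondent K τ (uniformizerIdele K v ϖ)⁻¹
        ((ρ.symm.trans (Field.absoluteGaloisGroup.toAlgEquiv (v.adicCompletion K) σ).toRingEquiv).trans ρ) := by
  obtain ⟨w, hwσ, hw⟩ := exists_weilGroup_of_isAbsArithFrob v hσ
  refine ⟨(canonicalArtin (v.adicCompletion K) w)⁻¹, isUniformizer_canonicalArtin_inv v hw, ?_⟩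
  rw [isArtinCorrespondent_uniformizerIdele_inv_iff]
  letI : Algebra K ℂ := τ.toAlgebra
  -- the embedding `e := ρ ∘ (K̄ → K̄_v)` as a `K`-algebra map
  let ρ' : AlgebraicClosure (v.adicCompletion K) →ₐ[K] ℂ :=
    { (ρ : AlgebraicClosure (v.adicCompletion K) →+* ℂ) with
      commutes' := fun x => by
        change ρ (algebraMap K (AlgebraicClosure (v.adicCompletion K)) x) = algebraMap K ℂ x
        exact RingHom.congr_fun hρ x }
  refine ⟨ρ'.comp (absClosureEmbedding K (v.adicCompletion K)), absGaloisRestrict K (v.adicCompletion K) σ, fun x => ?_, ?_⟩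
  · -- `e (γ • x) = σ̃ (e x)`
    change ρ (absClosureEmbedding K (v.adicCompletion K) (Field.absoluteGaloisGroup.toAlgEquiv K _ x)) =
      ρ (Field.absoluteGaloisGroup.toAlgEquiv (v.adicCompletion K) σ (ρ.symm (ρ (absClosureEmbedding K (v.adicCompletion K) x))))
    rw [RingEquiv.symm_apply_apply, ← Field.absoluteGaloisGroup.smul_def, absGaloisRestrict_apply_smul,
      Field.absoluteGaloisGroup.smul_def]
  · -- `[γ]^{ab} = ( ⟨ϖ⟩_v , K)`
    rw [← hwσ, absGaloisAbProj_absGaloisRestrict_weil_eq_inv, ← map_inv, ← map_inv, ideleArtinMap_apply]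

/-! ## §4 The unramified reading: `res σ` restricts to `Frob_v` on every finite abelian layer unramified at `v` -/

/-- **A local arithmetic Frobenius restricts to THE Frobenius `Frob_v ∈ Gal(L∕K)` on every finite abelian `L ⊆ K̄` unramified at `v`**:
`res σ` is an arithmetic Frobenius of `Γ_K` at the prime `𝔓₀` of `ℤ̄_K` cut out by `K̄ → K̄_v` (★ `isArithFrobAt_absGaloisRestrict_adicCompletionPrime_iff`),
its restriction to `L` is an arithmetic Frobenius at `𝔓₀ ∩ 𝓞 L` (★ `isArithFrobAt_absRestrictNormalHom`), and in an abelian group that pins `Frob_v`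
(★ `eq_galFrob`; the private assembly of ★ `HilbertClassFieldMaximal`, made public and fed with the local Frobenius; «L4» LA4-p04 (g2) census 06:02:57Z).
[cite: NeukirchANT1999, Ch. I §9 (9.4)–(9.5) and Ch. VI §5 Cor. (5.7)] [cite: CasselsFrohlichANT1967, Ch. VII §4.2 Corollary (iii) (PDF p. 211)] -/
theorem absRestrictNormalHom_absGaloisRestrict_eq_galFrob_of_isAbsArithFrob
    (L : IntermediateField K (AlgebraicClosure K)) [FiniteDimensional K L] [IsAbelianGalois K L] [NumberField L]
    (hunr : Algebra.IsUnramifiedIn (𝓞 L) v.asIdeal)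
    {σ : Field.absoluteGaloisGroup (v.adicCompletion K)} (hσ : IsAbsArithFrob σ) :
    absRestrictNormalHom L (absGaloisRestrict K (v.adicCompletion K) σ) = galFrob K L v := by
  have hq : IsNonarchimedeanLocalField.residueFieldCard (v.adicCompletion K) = Nat.card (𝓞 K ⧸ v.asIdeal) := by
    rw [Automorphic.residueFieldCard_adicCompletion_eq, v.residueCard_eq_card_quotient]
  have hF := (isArithFrobAt_absGaloisRestrict_adicCompletionPrime_iff K v hq σ).2 hσ
  haveI : (adicCompletionPrime K v).IsPrime := (adicCompletionPrime_mem_primesAbove K v).1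
  exact eq_galFrob (commute_of_isAbelianGalois L) hunr
    (comap_ringOfIntegersToIntegralClosure_mem_primesOver_of_mem_primesAbove _ (adicCompletionPrime_mem_primesAbove K v))
    (isArithFrobAt_absRestrictNormalHom _ hF)

end Literature.NumberTheory.NumberFields

end
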